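import Mathlib.Tactic.Linarith
import Mathlib.Tactic.NormNum
import Mathlib.Tactic.Ring
import HarnessLib

/-!
# The (0,1) cell of the ι-window, XLII: the product ground `B₁ × B₂`, XXIX — THE CORNER XIV (report [XLII] `H2-ZERO-ONE-42.md`):
# arithmetic shadow of COROLLARY TWO-STEP / GROWTH (the exposure calculus), LEMMA LAYER-FOUR (its valuation cases),
# the MONOMIAL MODEL's closed forms, PROPOSITION FIBRE-TYPES and PROPOSITION SLOPE-BUDGET

Family `hodge`, b2b cell `hweil` (helper of item stmt-HodgeConjecture-2524). Report
`run/shared/lean/b2b/hodge-weil/b2b-hweil-pv1-g54/H2-ZERO-ONE-42.md` ([XLII]). Context (the report's words, nothing of them formalised here): for a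
BALANCED thick two-block S-line `Y` (`π_*𝒪_Y = 𝒪_{bΘ}[t̄]`, `t̄² = Ψt̄ + Φ`) the x̃-layers at a point `p` have 1-part pole orders `k′_j` and t̄-part pole
orders `k″_j ≥ k′_j`; the INTERCEPT is `ι_j = k″_j − k′_j`, the hidden 1-layer has pole order `k̃′_j ≥ k′_j`; `a` is the pole order of `Φ₂` at `p` and `π`
that of `Ψ₁`. The report proves `k̃′_{j+2} ≥ k″_j + a` (HIDDEN-TRANSFER), `k̃′_{j+1} − k′_{j+1} ≤ ι_j` (DEFECT), `k̃′_{j+1} ≤ max(k″_{j+1}, π + k″_j)` (CAP),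
the all-layers LINK-4 («LAYER-FOUR») with its three valuation cases, computes the layers of the monomial model `Ψ = u^{-h}x̃^m, Φ = x̃²` in closed form,
and counts the local types of the seven fibre crossings under TRACE-GROWTH. The theorems below are the integer arithmetic of those statements. They
claim no geometry. HONEST FRAMING: census work inside the ladder's H2 test ((0,1) cell) on the SPECIAL fourfold `X₀`; nothing here is a rung; no case
of the Hodge conjecture is proved; no statement of [Markman 2025] / [Perry 2026] / [EdGFS 2025] is used.
-/

-- mandated namespace `Summit.HodgeConjecture.HodgeConjecture.…` (Problem = Summit) trips `linter.dupNamespace`; the lakefile disables it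
-- tree-wide (weak option), restated here so stand-alone elaboration is warning-free too.
set_option linter.dupNamespace false

namespace Summit.HodgeConjecture.HodgeConjecture.WeilTypeLadder

section ProductGroundTwentyNine

/-- **[XLII] 3.2 (COROLLARY TWO-STEP).** (a) Pointwise: from HIDDEN-TRANSFER `k̃′_{j+2} ≥ k″_j + a` and DEFECT `k̃′_{j+2} − k′_{j+2} ≤ ι_{j+1} =
k″_{j+1} − k′_{j+1}` follows `(k′_{j+2} − k′_{j+1}) + (k″_{j+1} − k″_j) ≥ a`. (b) Globally, with `d = ℓ + 2j` in both parts and the increments summing to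
at least `Σ_p a(p) = 4`: `ℓ′_{j+2} − ℓ′_{j+1} ≥ ℓ″_j − ℓ″_{j+1}`. [`linarith`] -/
theorem pg29_two_step :
    (∀ k1j1 k1j2 k2j k2j1 kh a : ℤ, kh ≥ k2j + a → kh - k1j2 ≤ k2j1 - k1j1 → (k1j2 - k1j1) + (k2j1 - k2j) ≥ a) ∧
    (∀ l1j1 l1j2 l2j l2j1 j : ℤ,
        ((l1j2 + 2 * (j + 2)) - (l1j1 + 2 * (j + 1))) + ((l2j1 + 2 * (j + 1)) - (l2j + 2 * j)) ≥ 4 →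
        l1j2 - l1j1 ≥ l2j - l2j1) := by
  refine ⟨fun k1j1 k1j2 k2j k2j1 kh a h1 h2 => by linarith, fun l1j1 l1j2 l2j l2j1 j h => by linarith⟩

/-- **[XLII] 3.3 (COROLLARY GROWTH).** From HIDDEN-TRANSFER `k̃′_{j+2} ≥ k″_j + a` and CAP `k̃′_{j+2} ≤ max(k″_{j+2}, π + k″_{j+1})`:
`max(k″_{j+2}, π + k″_{j+1}) ≥ k″_j + a`; in a `Ψ₁`-free frame (`π = 0`, and `k″_{j+1} ≤ k″_{j+2}` by monotonicity) this is `k″_{j+2} ≥ k″_j + a` —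
every t̄-pole propagates two layers up with increment `a`. [`le_trans`, `omega`] -/
theorem pg29_growth :
    (∀ k2j k2j1 k2j2 kh a π : ℤ, kh ≥ k2j + a → kh ≤ max k2j2 (π + k2j1) → max k2j2 (π + k2j1) ≥ k2j + a) ∧
    (∀ k2j k2j1 k2j2 kh a : ℤ, kh ≥ k2j + a → kh ≤ max k2j2 (0 + k2j1) → k2j1 ≤ k2j2 → k2j2 ≥ k2j + a) := by
  refine ⟨fun k2j k2j1 k2j2 kh a π h1 h2 => le_trans h1 h2, fun k2j k2j1 k2j2 kh a h1 h2 h3 => ?_⟩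
  have h4 : max k2j2 (0 + k2j1) = k2j2 := by
    rw [zero_add]; exact max_eq_left h3
  rw [h4] at h2
  exact le_trans h1 h2

/-- **[XLII] 4.1 (c) (LEMMA LAYER-FOUR, the valuation cases).** With `h = pole Ψ₂`, `f = pole Φ₃` (at a point with `Ψ₁ = 0`, `Φ₂` a unit) the
element of `Q_{i+4}` produced by the `O`-linearity of `θ_{i+4}` has pole order: case `f < h`: `pole(Φ₂Ψ₂² − Φ₃²) − h = max(2h, 2f) − h = h`; case
`f > h`: `pole(Φ₃ − Φ₂Ψ₂²/Φ₃) = max(f, 2h − f) = f`; tie case `f = h`, cancellation to `e ≤ 2h`: the bound `e − h ≤ h` and `e − h = h` iff no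
cancellation. So in the two generic cases the bound is `max(h, f)`. [`omega`] -/
theorem pg29_layer_four :
    (∀ h f : ℤ, 0 ≤ f → f < h → max (2 * h) (2 * f) - h = h ∧ max h f = h) ∧
    (∀ h f : ℤ, 0 ≤ h → h < f → max f (2 * h - f) = f ∧ max h f = f) ∧
    (∀ h e : ℤ, e ≤ 2 * h → e - h ≤ h) ∧
    (∀ h e : ℤ, (e - h = h ↔ e = 2 * h)) := by
  refine ⟨fun h f hf hfh => ⟨?_, ?_⟩, fun h f hh hhf => ⟨?_, ?_⟩, fun h e he => by omega, fun h e => by omega⟩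
  · rw [max_eq_left (by omega)]; omega
  · exact max_eq_left (le_of_lt hfh)
  · rw [max_eq_left (by omega)]
  · exact max_eq_right (le_of_lt hhf)

/-- **[XLII] 5.3 (PROPOSITION MONOMIAL MODEL, arithmetic of the closed forms).** For `Ψ = u^{-h}x̃^m`, `Φ = x̃²` the computed layers are
`k′_j = h(⌊(j+m)/(2m+2)⌋ + ⌊j/(2m+2)⌋)` and `k″_j = h(⌊(j+m+2)/(2m+2)⌋ + ⌊j/(2m+2)⌋)`. Consequences proved here for all `m ≥ 1`, `h`, `j`:
(a) `k″_j ≥ k′_j`; (b) TRANSFER with delay two, `k′_{j+2} ≥ k″_j`; (c) the intercept is at most `h`, `k″_j ≤ k′_j + h`; (d) periodicity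
`k′_{j+2m+2} = k′_j + 2h` (slope `h/(m+1)`); (e) at the period points `k′_{n(2m+2)} = 2nh` (the cumulative intercept there, by (c)–(d) and the report's
count of two intercept layers per period, equals this level). [monotonicity of `Nat` division, `Nat.add_div_right`, `Nat.add_mul_div_right`] -/
theorem pg29_monomial (m h j : ℕ) (hm : 1 ≤ m) :
    h * ((j + m + 2) / (2 * m + 2) + j / (2 * m + 2)) ≥ h * ((j + m) / (2 * m + 2) + j / (2 * m + 2)) ∧
    h * ((j + 2 + m) / (2 * m + 2) + (j + 2) / (2 * m + 2)) ≥ h * ((j + m + 2) / (2 * m + 2) + j / (2 * m + 2)) ∧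
    h * ((j + m + 2) / (2 * m + 2) + j / (2 * m + 2)) ≤ h * ((j + m) / (2 * m + 2) + j / (2 * m + 2)) + h ∧
    h * ((j + (2 * m + 2) + m) / (2 * m + 2) + (j + (2 * m + 2)) / (2 * m + 2)) = h * ((j + m) / (2 * m + 2) + j / (2 * m + 2)) + 2 * h ∧
    (∀ n : ℕ, h * ((n * (2 * m + 2) + m) / (2 * m + 2) + n * (2 * m + 2) / (2 * m + 2)) = 2 * n * h) := by
  have hP : 0 < 2 * m + 2 := by omega
  refine ⟨?_, ?_, ?_, ?_, ?_⟩
  · -- (a) monotonicity in the numerator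
    apply Nat.mul_le_mul_left
    have : (j + m) / (2 * m + 2) ≤ (j + m + 2) / (2 * m + 2) := Nat.div_le_div_right (by omega)
    omega
  · -- (b) first terms agree, second is monotone
    apply Nat.mul_le_mul_left
    have e1 : j + 2 + m = j + m + 2 := by omega
    rw [e1]
    have : j / (2 * m + 2) ≤ (j + 2) / (2 * m + 2) := Nat.div_le_div_right (by omega)
    omega
  · -- (c) (j+m+2)/P ≤ (j+m)/P + 1 since j+m+2 ≤ (j+m) + P
    have h1 : (j + m + 2) / (2 * m + 2) ≤ (j + m + (2 * m + 2)) / (2 * m + 2) := Nat.div_le_div_right (by omega)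
    have h2 : (j + m + (2 * m + 2)) / (2 * m + 2) = (j + m) / (2 * m + 2) + 1 := Nat.add_div_right _ hP
    rw [h2] at h1
    have h3 : h * ((j + m + 2) / (2 * m + 2) + j / (2 * m + 2)) ≤ h * ((j + m) / (2 * m + 2) + 1 + j / (2 * m + 2)) :=
      Nat.mul_le_mul_left _ (by omega)
    have h4 : h * ((j + m) / (2 * m + 2) + 1 + j / (2 * m + 2)) = h * ((j + m) / (2 * m + 2) + j / (2 * m + 2)) + h := by ring
    omega
  · -- (d) periodicity
    have e1 : j + (2 * m + 2) + m = (j + m) + (2 * m + 2) := by ring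
    rw [e1, Nat.add_div_right _ hP, Nat.add_div_right _ hP]
    ring
  · -- (e) period points
    intro n
    have e1 : n * (2 * m + 2) + m = m + n * (2 * m + 2) := by ring
    rw [e1, Nat.add_mul_div_right _ _ hP, Nat.div_eq_of_lt (by omega : m < 2 * m + 2), Nat.mul_div_cancel _ hP]
    ring

/-- **[XLII] 7.1 (PROPOSITION FIBRE-TYPES, the count).** Seven simple fibre crossings split into trace-type (`n_T`, each contributing `≥ 2` to
TRACE-GROWTH's visible pole mass `σ`), norm-type (`n_N`, each `≥ 1`) and type Z (`n_Z`, `Σ_xt(p_F) = Σ_xx(p_F) = 0`). With `σ ≤ 5` (c₀ ≤ 7, b ≥ 22):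
`n_T ≤ 2` and `n_Z ≥ 2 + n_T`; with `σ ≤ 6`: `n_Z ≥ 1 + n_T`; with `σ ≤ 7`: `n_Z ≥ n_T`. [`omega`] -/
theorem pg29_fibre_types (nT nN nZ σ : ℕ) (hsum : nT + nN + nZ = 7) (hmass : 2 * nT + nN ≤ σ) :
    (σ ≤ 5 → nT ≤ 2 ∧ 2 + nT ≤ nZ) ∧ (σ ≤ 6 → 1 + nT ≤ nZ) ∧ (σ ≤ 7 → nT ≤ nZ) := by
  refine ⟨fun h5 => ⟨by omega, by omega⟩, fun h6 => by omega, fun h7 => by omega⟩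

/-- **[XLII] 7.3 (b) (PROPOSITION SLOPE-BUDGET, arithmetic; the geometric step is CONDITIONAL on CONJECTURE TRANSFER-3 and is the report's, not
Lean's).** If balanced carriers supply a persistent intercept of total `S` from layer 2 to layer `b − 4`, TRANSFER-3 turns it into 1-part slope
`≥ S/3` over `b − 6` layers, against the total 1-part rise `2b + 15` (TOP, `|C′| = 0`): `S·(b − 6) ≤ 3(2b + 15)`. Hence `S ≤ 11` for `b ≥ 22`,
`S ≤ 8` for `b ≥ 34`; and net of the `Φ₂`-forced slope (`S·(b − 6) ≤ 3·23`): `S ≤ 4` for `b ≥ 22` — against the `10 + κ = 17` PROFILE needs.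
[case split at the bound, `Nat.mul_le_mul_right`, `omega`] -/
theorem pg29_slope_budget :
    (∀ b S : ℕ, 22 ≤ b → S * (b - 6) ≤ 3 * (2 * b + 15) → S ≤ 11) ∧
    (∀ b S : ℕ, 34 ≤ b → S * (b - 6) ≤ 3 * (2 * b + 15) → S ≤ 8) ∧
    (∀ b S : ℕ, 22 ≤ b → S * (b - 6) ≤ 3 * 23 → S ≤ 4) := by
  refine ⟨fun b S hb hS => ?_, fun b S hb hS => ?_, fun b S hb hS => ?_⟩
  · rcases Nat.lt_or_ge S 12 with h | h
    · omega
    · have hm : 12 * (b - 6) ≤ S * (b - 6) := Nat.mul_le_mul_right (b - 6) h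
      omega
  · rcases Nat.lt_or_ge S 9 with h | h
    · omega
    · have hm : 9 * (b - 6) ≤ S * (b - 6) := Nat.mul_le_mul_right (b - 6) h
      omega
  · rcases Nat.lt_or_ge S 5 with h | h
    · omega
    · have hm : 5 * (b - 6) ≤ S * (b - 6) := Nat.mul_le_mul_right (b - 6) h
      omega

end ProductGroundTwentyNine

end Summit.HodgeConjecture.HodgeConjecture.WeilTypeLadder
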